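import Summits.CriticalPhenomena.PercolationContinuityZ3.Theorems.PercNearOneGluingNoHeavyLowerTailThreePointHalvingCanonicalSplit
import HarnessLib

/-!
# The halving lemma (v) as an inequality between two functionals of ONE `s|a|c` configuration
# (Sahi programme, prover prim-sahi-p2 gen 47)

Support file (`--supports stmt-CriticalPhenomena-4575`, helper).  No definitions, no named facts, no sorries; standard axioms.
Memo `run/shared/lean/prim/prim-sahi/FROM-prim-sahi-p2-gen47-RESAMPLING.md` §0(9), §2e; `prim-sahi-p2/PROOF-E3.md` §57 (57c).

Combining `HalvingResample.halvingUD_of_boundaryResample` ((v) ⟸ (W): `Λ ≤ μ(U ∩ D)`) with the canonical-split identity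
`HalvingResample.sum_P1_eq_sum_S0_layer` (applied once from `s` and once from `c`): `μ(U ∩ D) = μ(P1) + μ(P2)` is itself a weighted sum over
the `s|a|c` configurations `η` — of `w_{off E_a^s(η)}(η)·λ_a(C_s(η)) + w_{off E_a^c(η)}(η)·λ_a(C_c(η))` (`λ_a(A)` = probability that `a` has an open
pair into `A`, `E_a^s(η)` = the pairs from `a` into the `a`-free cluster of `s`).  Hence:

* `sum_X_eq_sum_S0_layers` — `Σ_ξ wtW ξ·1_{U∩D}(ξ) = Σ_η 1_{s|a|c}(η)·[w_{off E^s}(η)(1 − Π_{E^s}(1−p)) + w_{off E^c}(η)(1 − Π_{E^c}(1−p))]`;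
* **`halvingUD_of_oneConfiguration`** — if the two-copy boundary sum `Λ` of `…ThreePointHalvingResample` is at most that one-configuration sum, then
  `μ(U)·μ(D) ≤ 2·μ(U ∩ D)`.  Both sides of the hypothesis are finite sums indexed by the `s|a|c` configurations (the left one with a second,
  independent copy supplying the boundary pairs), so the halving lemma is reduced to comparing, configuration class by configuration class,
  'a's own closed pairs into C_s and into C_c' against 'one fresh layer at the whole cluster of a reaching both C_s and C_c'.
-/

noncomputable section

open Classical

namespace Summit.CriticalPhenomena.PercolationContinuityZ3.Theorems

namespace HalvingResample

open Finset MeasureTheory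
open Literature.Probability.Percolation Literature.Probability.Percolation.DecisionTree
open Literature.Probability.LatticeModels

variable {V : Type*} [Fintype V]

/-- **`μ(U ∩ D)` over the `s|a|c` configurations.**  With `P1 = {a↔s, s↮c}`, `P2 = {a↔c, c↮s}` (disjoint, union `U ∩ D`) and the canonical-split
identity from `s` and from `c`:
`Σ_ξ wtW ξ·1[(a↔s ∨ a↔c) ∧ s↮c](ξ) = Σ_η 1[s|a|c](η)·(w_{off E^s(η)}(η)·(1 − Π_{E^s(η)}(1−p)) + w_{off E^c(η)}(η)·(1 − Π_{E^c(η)}(1−p)))`,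
`E^s(η)` = pairs `s(a,x)` with `x` in the cluster of `s` after deleting the pairs at `a`, `E^c` likewise. [this work] -/
theorem sum_X_eq_sum_S0_layers (p : Sym2 V → ℝ) {s a c : V} (hsa : s ≠ a) (hca : c ≠ a) :
    ∑ ξ ∈ (Finset.univ : Finset (Sym2 V)).powerset, wtW Finset.univ p ξ *
        ind {ξ : Finset (Sym2 V) | ((openGraph (↑ξ : Set (Sym2 V))).Reachable a s ∨ (openGraph (↑ξ : Set (Sym2 V))).Reachable a c) ∧
          ¬ (openGraph (↑ξ : Set (Sym2 V))).Reachable s c} ξ =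
    ∑ η ∈ (Finset.univ : Finset (Sym2 V)).powerset,
      ind {η : Finset (Sym2 V) | ¬ (openGraph (↑η : Set (Sym2 V))).Reachable a s ∧
          ¬ (openGraph (↑η : Set (Sym2 V))).Reachable a c ∧ ¬ (openGraph (↑η : Set (Sym2 V))).Reachable s c} η *
      ((wtW (Finset.univ \ Finset.univ.filter (fun e : Sym2 V => ∃ x : V, e = s(a, x) ∧
            (openGraph (↑(η \ Finset.univ.filter (fun e : Sym2 V => a ∈ e)) : Set (Sym2 V))).Reachable s x)) p η *
        (1 - ∏ e ∈ Finset.univ.filter (fun e : Sym2 V => ∃ x : V, e = s(a, x) ∧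
            (openGraph (↑(η \ Finset.univ.filter (fun e : Sym2 V => a ∈ e)) : Set (Sym2 V))).Reachable s x), (1 - p e))) +
      (wtW (Finset.univ \ Finset.univ.filter (fun e : Sym2 V => ∃ x : V, e = s(a, x) ∧
            (openGraph (↑(η \ Finset.univ.filter (fun e : Sym2 V => a ∈ e)) : Set (Sym2 V))).Reachable c x)) p η *
        (1 - ∏ e ∈ Finset.univ.filter (fun e : Sym2 V => ∃ x : V, e = s(a, x) ∧
            (openGraph (↑(η \ Finset.univ.filter (fun e : Sym2 V => a ∈ e)) : Set (Sym2 V))).Reachable c x), (1 - p e)))) := by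
  have h1 := sum_P1_eq_sum_S0_layer p hsa c
  have h2 := sum_P1_eq_sum_S0_layer p hca s
  set XU : Set (Finset (Sym2 V)) := {ξ | ((openGraph (↑ξ : Set (Sym2 V))).Reachable a s ∨
      (openGraph (↑ξ : Set (Sym2 V))).Reachable a c) ∧ ¬ (openGraph (↑ξ : Set (Sym2 V))).Reachable s c} with hXU
  set P1 : Set (Finset (Sym2 V)) := {ξ | (openGraph (↑ξ : Set (Sym2 V))).Reachable a s ∧
      ¬ (openGraph (↑ξ : Set (Sym2 V))).Reachable s c} with hP1
  set P2 : Set (Finset (Sym2 V)) := {ξ | (openGraph (↑ξ : Set (Sym2 V))).Reachable a c ∧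
      ¬ (openGraph (↑ξ : Set (Sym2 V))).Reachable c s} with hP2
  -- the `S₀` of the second identity is the same set (symmetry of `↔`)
  have hS0 : {η : Finset (Sym2 V) | ¬ (openGraph (↑η : Set (Sym2 V))).Reachable a c ∧
      ¬ (openGraph (↑η : Set (Sym2 V))).Reachable a s ∧ ¬ (openGraph (↑η : Set (Sym2 V))).Reachable c s} =
      {η : Finset (Sym2 V) | ¬ (openGraph (↑η : Set (Sym2 V))).Reachable a s ∧
      ¬ (openGraph (↑η : Set (Sym2 V))).Reachable a c ∧ ¬ (openGraph (↑η : Set (Sym2 V))).Reachable s c} := by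
    ext η
    simp only [Set.mem_setOf_eq]
    constructor
    · rintro ⟨h1, h2, h3⟩; exact ⟨h2, h1, fun h => h3 h.symm⟩
    · rintro ⟨h1, h2, h3⟩; exact ⟨h2, h1, fun h => h3 h.symm⟩
  rw [hS0] at h2
  -- `1_{U∩D} = 1_{P1} + 1_{P2}` pointwise
  have hsplit : ∀ ξ : Finset (Sym2 V), ind XU ξ = ind P1 ξ + ind P2 ξ := by
    intro ξ
    by_cases has : (openGraph (↑ξ : Set (Sym2 V))).Reachable a s <;>
      by_cases hac : (openGraph (↑ξ : Set (Sym2 V))).Reachable a c <;>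
      by_cases hsc : (openGraph (↑ξ : Set (Sym2 V))).Reachable s c
    · rw [ind_of_not_mem (fun h : ξ ∈ XU => h.2 hsc), ind_of_not_mem (fun h : ξ ∈ P1 => h.2 hsc),
        ind_of_not_mem (fun h : ξ ∈ P2 => h.2 hsc.symm)]; ring
    · exact absurd (has.symm.trans hac) hsc
    · rw [ind_of_not_mem (fun h : ξ ∈ XU => h.2 hsc), ind_of_not_mem (fun h : ξ ∈ P1 => h.2 hsc),
        ind_of_not_mem (fun h : ξ ∈ P2 => hac h.1)]; ring
    · have hx : ξ ∈ XU := ⟨Or.inl has, hsc⟩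
      have hy : ξ ∈ P1 := ⟨has, hsc⟩
      rw [ind_of_mem hx, ind_of_mem hy, ind_of_not_mem (fun h : ξ ∈ P2 => hac h.1)]; ring
    · rw [ind_of_not_mem (fun h : ξ ∈ XU => h.2 hsc), ind_of_not_mem (fun h : ξ ∈ P1 => has h.1),
        ind_of_not_mem (fun h : ξ ∈ P2 => h.2 hsc.symm)]; ring
    · have hx : ξ ∈ XU := ⟨Or.inr hac, hsc⟩
      have hz : ξ ∈ P2 := ⟨hac, fun h => hsc h.symm⟩
      rw [ind_of_mem hx, ind_of_not_mem (fun h : ξ ∈ P1 => has h.1), ind_of_mem hz]; ring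
    · rw [ind_of_not_mem (fun h : ξ ∈ XU => h.2 hsc), ind_of_not_mem (fun h : ξ ∈ P1 => has h.1),
        ind_of_not_mem (fun h : ξ ∈ P2 => hac h.1)]; ring
    · rw [ind_of_not_mem (fun h : ξ ∈ XU => has (h.1.elim id fun h' => absurd h' hac)),
        ind_of_not_mem (fun h : ξ ∈ P1 => has h.1), ind_of_not_mem (fun h : ξ ∈ P2 => hac h.1)]; ring
  have hL : ∑ ξ ∈ (Finset.univ : Finset (Sym2 V)).powerset, wtW Finset.univ p ξ * ind XU ξ =
      ∑ ξ ∈ (Finset.univ : Finset (Sym2 V)).powerset, wtW Finset.univ p ξ * ind P1 ξ +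
        ∑ ξ ∈ (Finset.univ : Finset (Sym2 V)).powerset, wtW Finset.univ p ξ * ind P2 ξ := by
    rw [← Finset.sum_add_distrib]
    refine Finset.sum_congr rfl fun ξ _ => ?_
    rw [hsplit]; ring
  rw [hL, h1, h2, ← Finset.sum_add_distrib]
  refine Finset.sum_congr rfl fun η _ => ?_
  ring

/-- **The halving lemma from a one-configuration comparison.**  `μ = prodBernoulli w`, `U = {s↔a} ∪ {c↔a}`, `D = {s↮c}`, `s ≠ a`, `c ≠ a`.  If the
two-copy boundary sum `Λ = Σ_K Σ_C wtW K wtW C·1[K ∈ s|a|c; C meets E(C_a(K),C_s(K)) and E(C_a(K),C_c(K))]` is at most the one-configuration sum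
`Σ_η 1_{s|a|c}(η)·[w_{off E^s}(η)(1 − Π_{E^s(η)}(1−p)) + w_{off E^c}(η)(1 − Π_{E^c(η)}(1−p))]` (= `μ(U ∩ D)` by `sum_X_eq_sum_S0_layers`), then
`μ(U)·μ(D) ≤ 2·μ(U ∩ D)`.  [this work] -/
theorem halvingUD_of_oneConfiguration (w : Sym2 V → unitInterval) {s a c : V} (hsa : s ≠ a) (hca : c ≠ a)
    (hW : ∑ K ∈ (Finset.univ : Finset (Sym2 V)).powerset, ∑ C ∈ (Finset.univ : Finset (Sym2 V)).powerset,
        wtW Finset.univ (fun e => (w e : ℝ)) K * wtW Finset.univ (fun e => (w e : ℝ)) C *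
          ind {x : Finset (Sym2 V) × Finset (Sym2 V) |
              (¬ (openGraph (↑x.1 : Set (Sym2 V))).Reachable a s ∧ ¬ (openGraph (↑x.1 : Set (Sym2 V))).Reachable a c ∧
                  ¬ (openGraph (↑x.1 : Set (Sym2 V))).Reachable s c) ∧
                (∃ e ∈ x.2, ∃ u v : V, e = s(u, v) ∧ (openGraph (↑x.1 : Set (Sym2 V))).Reachable a u ∧
                  (openGraph (↑x.1 : Set (Sym2 V))).Reachable s v) ∧
                (∃ e ∈ x.2, ∃ u v : V, e = s(u, v) ∧ (openGraph (↑x.1 : Set (Sym2 V))).Reachable a u ∧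
                  (openGraph (↑x.1 : Set (Sym2 V))).Reachable c v)} (K, C) ≤
      ∑ η ∈ (Finset.univ : Finset (Sym2 V)).powerset,
        ind {η : Finset (Sym2 V) | ¬ (openGraph (↑η : Set (Sym2 V))).Reachable a s ∧
            ¬ (openGraph (↑η : Set (Sym2 V))).Reachable a c ∧ ¬ (openGraph (↑η : Set (Sym2 V))).Reachable s c} η *
        ((wtW (Finset.univ \ Finset.univ.filter (fun e : Sym2 V => ∃ x : V, e = s(a, x) ∧
              (openGraph (↑(η \ Finset.univ.filter (fun e : Sym2 V => a ∈ e)) : Set (Sym2 V))).Reachable s x)) (fun e => (w e : ℝ)) η *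
          (1 - ∏ e ∈ Finset.univ.filter (fun e : Sym2 V => ∃ x : V, e = s(a, x) ∧
              (openGraph (↑(η \ Finset.univ.filter (fun e : Sym2 V => a ∈ e)) : Set (Sym2 V))).Reachable s x), (1 - (w e : ℝ)))) +
        (wtW (Finset.univ \ Finset.univ.filter (fun e : Sym2 V => ∃ x : V, e = s(a, x) ∧
              (openGraph (↑(η \ Finset.univ.filter (fun e : Sym2 V => a ∈ e)) : Set (Sym2 V))).Reachable c x)) (fun e => (w e : ℝ)) η *
          (1 - ∏ e ∈ Finset.univ.filter (fun e : Sym2 V => ∃ x : V, e = s(a, x) ∧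
              (openGraph (↑(η \ Finset.univ.filter (fun e : Sym2 V => a ∈ e)) : Set (Sym2 V))).Reachable c x), (1 - (w e : ℝ)))))) :
    (prodBernoulli w).real (openConn s a ∪ openConn c a) * (prodBernoulli w).real ((openConn s c)ᶜ) ≤
      2 * (prodBernoulli w).real ((openConn s a ∪ openConn c a) ∩ (openConn s c)ᶜ) := by
  have hdet : ∀ X : Set (BondConfig V), DeterminedBy X (↑(Finset.univ : Finset (Sym2 V)) : Set (Sym2 V)) := by
    intro X
    rw [determinedBy_iff]
    intro ω ω' h
    rw [Finset.coe_univ, Set.inter_univ, Set.inter_univ] at h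
    rw [h]
  -- `μ(U ∩ D)` as the finite sum of `1_{U∩D}`
  have eX : (prodBernoulli w).real ((openConn s a ∪ openConn c a) ∩ (openConn s c)ᶜ) =
      ∑ K ∈ (Finset.univ : Finset (Sym2 V)).powerset, wtW Finset.univ (fun e => (w e : ℝ)) K *
        ind {K : Finset (Sym2 V) | (↑K : Set (Sym2 V)) ∈ (openConn s a ∪ openConn c a) ∩ (openConn s c)ᶜ} K := by
    rw [DecisionTree.prodBernoulli_real_eq_PrW w (hdet ((openConn s a ∪ openConn c a) ∩ (openConn s c)ᶜ))
      (X := {K : Finset (Sym2 V) | (↑K : Set (Sym2 V)) ∈ (openConn s a ∪ openConn c a) ∩ (openConn s c)ᶜ})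
      (fun S _ => Iff.rfl), PrW_eq_sum_ind]
  have hset : {K : Finset (Sym2 V) | (↑K : Set (Sym2 V)) ∈ (openConn s a ∪ openConn c a) ∩ (openConn s c)ᶜ} =
      {ξ : Finset (Sym2 V) | ((openGraph (↑ξ : Set (Sym2 V))).Reachable a s ∨ (openGraph (↑ξ : Set (Sym2 V))).Reachable a c) ∧
          ¬ (openGraph (↑ξ : Set (Sym2 V))).Reachable s c} := by
    ext K
    simp only [Set.mem_setOf_eq, Set.mem_inter_iff, Set.mem_union, Set.mem_compl_iff, openConn]
    constructor
    · rintro ⟨h | h, hsc⟩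
      · exact ⟨Or.inl h.symm, hsc⟩
      · exact ⟨Or.inr h.symm, hsc⟩
    · rintro ⟨h | h, hsc⟩
      · exact ⟨Or.inl h.symm, hsc⟩
      · exact ⟨Or.inr h.symm, hsc⟩
  have key := sum_X_eq_sum_S0_layers (fun e => (w e : ℝ)) hsa hca
  refine halvingUD_of_boundaryResample w s a c ?_
  rw [eX, hset, key]
  exact hW

end HalvingResample

end Summit.CriticalPhenomena.PercolationContinuityZ3.Theorems
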